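import Summits.MatrixMultiplication.OmegaCensus.STPPVosperSlackTwoLawT
import Summits.MatrixMultiplication.OmegaCensus.STPPVosperSlackTwoRows53AAsm
import Summits.MatrixMultiplication.OmegaCensus.STPPVosperSlackTwoRows53BAsm
import Summits.MatrixMultiplication.OmegaCensus.STPPVosperSlackTwoRows53CAsm
import Summits.MatrixMultiplication.OmegaCensus.STPPVosperSlackTwoRows53TblA1
import Summits.MatrixMultiplication.OmegaCensus.STPPVosperSlackTwoRows53TblB1
import Summits.MatrixMultiplication.OmegaCensus.STPPVosperTilingWordsPrunedQ
import Summits.MatrixMultiplication.OmegaCensus.STPPVosperTilingWordsPruned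
import Summits.MatrixMultiplication.OmegaCensus.STPPHamidouneRodsethInverseTheorem
import Summits.MatrixMultiplication.OmegaCensus.STPPKernelListerLeaf

/-!
# ω-census (abelian STPP census): `{(2,3,3),(2,3,3),(2,3,3)} ⊄ ℤ₅₃` by the slack-2 partition law, table form (kernel, unconditional)

HONEST FRAMING (pub-omega census; verbatim): lottery ticket; floor = certified bounds/negative ranges.
Census EXCLUSION (seat pub-omega-stpp-2 gen 31, 2026-08-29), family (b2).  The fifth of the six tree-law survivors of the ℤ₅₃ STPP census
(`STPPKernelListerKillsZ53.lean`: `234_235`, `223_332_342`, `233_233_323`, `233_323_332` killed there; `333_333`, `233_233_233` left) — the three-block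
leaf `{(2,3,3)³}`, volume `54 = 53 + 1`, slack 2 at any block read `(a, b, c) = (2, 3, 3)`: `z + b + vol + a + L = 12 + 3 + 18 + 2 + 18 = 53` — has NO
realisation: `no_isSTPP_of_slack_two_tables` (`STPPVosperSlackTwoLawT.lean`, stpp-1 g33) at block `0` (`a = 2`: the pair `A₀` is its own
progression-minus-a-term), other blocks `[1, 2]` of sizes `(2,3,3)`, `(2,3,3)`, with the kernel rows `rows53A_choose` (case A, 234 dihedral
representatives of the 3-shapes, table `tblZ53A`, 5 entries), `rows53B_choose` (case B′, 26 representatives of the 2-shapes — the interval shape `[0,3]`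
by branch peeling — table `tblZ53B`, 5 entries), `rows53C_lit` (case C, PRUNED checker `caseCDeadTP`, `qShapesC 3 × pShapesC 53 2 × 12` holes, table
`tblZ53C = []`: no case-C leaf exists at `p = 53`) and the words-cover table rows `dead53A` (role-swapped, `blockDiffsWQ`), `dead53B` (direct,
`blockDiffsWP`) (`STPPVosperSlackTwoRows53*.lean`, tables `STPPVosperSlackTwoTablesZ53.lean`, all this seat; python mirrors of the ℤ₅₉ programme of
stpp-1 g33 / stpp-2 g27 run at `p = 53`, HOME `pub-omega-stpp-2-g31/code/s2/`).  Hamidoune–Rødseth is the tree theorem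
`hamidouneRodsethInverseTheorem_holds`, so the kill is UNCONDITIONAL.  Census consequence (lead's words only): ℤ₅₃ front 5/6 KERNEL-dead; the capstone
`CubeNB.volume_le_card_zmod53_of_not_realizable` (`STPPKernelListerOrderN53Z.lean`) loses its `233_233_233` hypothesis (`…OrderN53Y.lean`).  Nothing here is
progress on `ω`.

References: H. Cohn, R. Kleinberg, B. Szegedy, C. Umans, FOCS 2005 (arXiv:math/0511460), Def. 5.1; A. G. Vosper, J. London Math. Soc. 31 (1956);
Y. O. Hamidoune, Ø. J. Rødseth, Acta Arith. 92 (2000) 251–262.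
-/

open Finset
open scoped Pointwise

namespace Summit.MatrixMultiplication.OmegaCensus.CubeNB

open Literature.Computability.AlgebraicComplexity
open Literature.Combinatorics.Additive
open Summit.MatrixMultiplication.OmegaCensus.STPPKneser
open Summit.MatrixMultiplication.OmegaCensus.CubeNB.S2

/-- **`{(2,3,3),(2,3,3),(2,3,3)} ⊄ ℤ₅₃` (kernel, unconditional).**  No simultaneous-triple-product family of `ℤ/53` has size pattern
`(|Aᵢ|,|Bᵢ|,|Cᵢ|) = (2,3,3)` for all three `i`. [cite: CohnKleinbergSzegedyUmans2005, Def. 5.1]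
[cite: Vosper1956, main theorem; Nathanson1996, Thm 2.7] [cite: HamidouneRodseth2000, main theorem (§1, p. 252)] -/
theorem no_isSTPP_zmod53_233_233_233 (A B C : Fin 3 → Finset (ZMod 53)) (hS : IsSTPP A B C)
    (hA : ∀ i, #(A i) = ![2, 2, 2] i) (hB : ∀ i, #(B i) = ![3, 3, 3] i) (hC : ∀ i, #(C i) = ![3, 3, 3] i) : False := by
  haveI : Fact (Nat.Prime 53) := ⟨by norm_num⟩
  have hAne : ∀ i, (A i).Nonempty := fun i => card_pos.1 (by rw [hA]; fin_cases i <;> simp)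
  have hBne : ∀ i, (B i).Nonempty := fun i => card_pos.1 (by rw [hB]; fin_cases i <;> simp)
  have hCne : ∀ i, (C i).Nonempty := fun i => card_pos.1 (by rw [hC]; fin_cases i <;> simp)
  have e0 : (univ : Finset (Fin 3)).erase 0 = {1, 2} := by decide
  have hz : ∑ k ∈ (univ : Finset (Fin 3)).erase 0, #(A k) * #(C k) = 12 := by
    rw [e0, Finset.sum_pair (by decide)]; simp [hA, hC]
  have hL : ∑ k ∈ (univ : Finset (Fin 3)).erase 0, #(B k) * #(C k) = 18 := by
    rw [e0, Finset.sum_pair (by decide)]; simp [hB, hC]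
  have hszsA : ([1, 2] : List (Fin 3)).map (fun k => (#(A k), #(B k), #(C k))) = [(2, 3, 3), (2, 3, 3)] := by simp [hA, hB, hC]
  have hszsB : ([1, 2] : List (Fin 3)).map (fun k => (#(B k), #(A k), #(C k))) = [(3, 2, 3), (3, 2, 3)] := by simp [hA, hB, hC]
  have hdeadA : ∀ e ∈ tblZ53A, CoverDead 53 3 0 [(2, 3, 3), (2, 3, 3)] e.1 e.2 :=
    coverDead_forall_of_rows_swapped (blockEnumSound_blockDiffsWQ 53) fun e he => dead53A e he
  have hdeadB : ∀ e ∈ tblZ53B, CoverDead 53 3 0 [(3, 2, 3), (3, 2, 3)] e.1 e.2 :=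
    coverDead_forall_of_rows (blockEnumSound_blockDiffsWP 53) fun e he => dead53B e he
  have hdeadC : ∀ e ∈ tblZ53C, CoverDead 53 3 0 [(2, 3, 3), (2, 3, 3)] e.1 e.2 := by
    intro e he
    simp [tblZ53C] at he
  exact no_isSTPP_of_slack_two_tables hamidouneRodsethInverseTheorem_holds hS hAne hBne hCne 0 ⟨1, by decide⟩
    (a := 2) (b := 3) (c := 3) (L := 18) (z := 12) (vol := 18) (tblA := tblZ53A) (tblB := tblZ53B) (tblC := tblZ53C)
    (by rw [hA]; rfl) (by rw [hB]; rfl) (by rw [hC]; rfl) hz hL rfl (by norm_num)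
    (Or.inl rfl) (by norm_num) (by norm_num) (by norm_num) (by norm_num)
    [1, 2] (by decide) (fun k => by fin_cases k <;> decide) hszsA hszsB hdeadA hdeadB hdeadC
    rows53A_choose rows53B_choose (fun Q hQ P hP h hh => Or.inr (rows53C_lit Q hQ P hP h hh))

/-! ## Non-realisability form (for the kernel lister's dead list at order 53) -/

section Dead

open Summit.MatrixMultiplication.OmegaCensus.KLister

/-- The class `233_233_233` is not realisable in `ℤ₅₃`. [cite: CohnKleinbergSzegedyUmans2005, Def. 5.1] -/
theorem notRealizable_Z53_233_233_233 : ¬ Realizable (ZMod 53) ([(2, 3, 3), (2, 3, 3), (2, 3, 3)] : List Shape) := by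
  intro h
  obtain ⟨A, B, C, hS, hc⟩ := h.out
  exact no_isSTPP_zmod53_233_233_233 A B C hS (fun i => by fin_cases i <;> exact (hc _).2.2.2.1)
    (fun i => by fin_cases i <;> exact (hc _).2.2.2.2.1) (fun i => by fin_cases i <;> exact (hc _).2.2.2.2.2)

end Dead

end Summit.MatrixMultiplication.OmegaCensus.CubeNB
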